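import Summits.Ventures.Crystal3D.Theorems.StickyWulffConstantTextureBuildRiserHexagons
import Summits.Ventures.Crystal3D.Theorems.StickyWulffConstantTextureBuildRiserAxis
import Summits.Ventures.Crystal3D.Theorems.StickyWulffConstantTextureBuildSpecials
import HarnessLib

/-!
# The RISER PACKAGE (B6), part 5: BOX CELLS of the riser input — their grains, the free horizontal faces, and row (RR) of `BoxRow`
# (lane T, crux `TextureLiminfV5`, stmt-Ventures-23912; design memo HOME/wulff-p2/g21/B6-DESIGN-g21.md §2 (RR); target `RiserPackage₇` of '…TextureBuildMeshV7')

HONEST FRAMING. Venture `Summits/Ventures/Crystal3D` (cell `crystal3d-full`), route `route-Ventures-StickyWulffConstant`, helper `--supports` the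
law-v5 crux `TextureLiminfV5` (stmt-Ventures-23912).  Bookkeeping over the labelled cells of the riser input `Mesh₅.riserInput` (standard axioms; no mesh
constructed; F-C1 not moved).

* `grain_riserInput_box` — a piece inside riser box `r` has grain `riserGrain r T` (its claim); `grain_box_mem` (one of the two column grains);
  `grain_box_eq_rtL_iff` (claimed `f = rtL r` iff inside the hexagon prism of an occupied riser `f`-site);
* `sharedAxis_columns` — (L-ax) instantiated: the class frames of the two column grains share the axis `rn r` ('…RiserAxis' + `hframe`);
  `lawW_columns_eq_zero_of_pm_rn` — a contact across a HORIZONTAL plane (normal `± rn r`) between the two column grains is FREE;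
* **`boxRow_same_box`** — ROW (RR) of `BoxRow` for the riser input: two box cells of ONE box with different grains, at a generic contact point: the facet
  datum is a wall of the `f`-cell's hexagon prism (CURTAIN special) or one of its faces (FREE).
-/

noncomputable section

open scoped BigOperators InnerProductSpace

namespace Summit.Ventures.Crystal3D.Cruxes.TextureLiminf.TexShadow

open Summit.Ventures.Crystal3D Summit.Ventures.Crystal3D.Theorems Set

namespace Mesh₅

variable {C R₀ : ℝ} {N : ℕ} {x : Fin N → E3} {rc : RiseredCover C R₀ N x} {δ : ℝ} (μ : Mesh₅ rc δ)
  (ct : (f : Fin rc.ng) → TentCert (rc.tent f)) (τ : Fin rc.nk → ℝ)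

/-! ### The grain of a box cell is its claim -/

/-- **A piece inside riser box `r` has grain `riserGrain r T`.** -/
theorem grain_riserInput_box {r : Fin rc.nr} {i : Fin (μ.riserInput ct τ).cells.M}
    (hi : polytope ((μ.riserInput ct τ).cells.Hp i) ⊆ polytope (μ.HB r)) :
    (μ.riserInput ct τ).grain i = μ.riserGrain r ((μ.riserInput ct τ).cells.T ((μ.riserInput ct τ).cells.idx i)) := by
  obtain ⟨z, hz⟩ := (μ.riserInput ct τ).cells.hne ((μ.riserInput ct τ).cells.idx i)
  have hzr : z ∈ polytope (μ.HB r) := hi hz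
  rcases (μ.riserInput ct τ).grain_cases i with ⟨j, hj⟩ | ⟨j', hj'⟩ | ⟨k, hk, -⟩ | ⟨l, hl, -⟩ | ⟨r', hr', hf⟩
  · exact absurd (μ.hCD _ j (hj hz)) (Set.disjoint_left.1 (μ.hBD r _) hzr)
  · exact absurd (mem_iUnion.2 ⟨j', hj' hz⟩) (Set.disjoint_left.1 (μ.hBD r _) hzr)
  · exact absurd (hk hz) (Set.disjoint_left.1 (μ.hBP r k) hzr)
  · exact absurd (hl hz) (Set.disjoint_left.1 (μ.hBQ r l) hzr)
  · have hrr : r' = r := by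
      by_contra hne
      exact Set.disjoint_left.1 (μ.hBB r' r hne) (hr' hz) hzr
    subst hrr
    exact hf

/-- The grain of a box cell is one of the two column grains. -/
theorem grain_box_mem {r : Fin rc.nr} {i : Fin (μ.riserInput ct τ).cells.M}
    (hi : polytope ((μ.riserInput ct τ).cells.Hp i) ⊆ polytope (μ.HB r)) :
    (μ.riserInput ct τ).grain i = rc.rtL r ∨ (μ.riserInput ct τ).grain i = rc.rtR r := by
  rw [μ.grain_riserInput_box ct τ hi]; exact μ.riserGrain_mem r _

/-- **A box cell is claimed by `f = rtL r` iff it lies in the hexagon prism of an occupied riser `f`-site.** -/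
theorem grain_box_eq_rtL_iff {r : Fin rc.nr} {i : Fin (μ.riserInput ct τ).cells.M}
    (hi : polytope ((μ.riserInput ct τ).cells.Hp i) ⊆ polytope (μ.HB r)) :
    (μ.riserInput ct τ).grain i = rc.rtL r ↔
      ∃ c ∈ μ.occF r, polytope ((μ.riserInput ct τ).cells.Hp i) ⊆ polytope (μ.hexPrism r c (μ.rlayer r c)) := by
  rw [μ.grain_riserInput_box ct τ hi, μ.riserGrain_eq_rtL_iff]
  constructor
  · rintro ⟨c, hc, hT⟩
    exact ⟨c, hc, cell_subset_of_subset_T (μ.hexPrism_subset_𝓗 ct τ hc) hT⟩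
  · rintro ⟨c, hc, hsub⟩
    exact ⟨c, hc, subset_T_of_cell_subset (μ.hexPrism_subset_𝓗 ct τ hc) ((μ.riserInput ct τ).cells.hne _) hsub⟩

/-! ### The shared axis of the two column grains; free horizontal faces -/

include μ in
/-- **(L-ax) for the box**: every pair of class frames of the two column grains shares the axis `rn r`. -/
theorem sharedAxis_columns (r : Fin rc.nr) (a b : ℤ) : SharedAxis (rc.rn r) ((rc.tent (rc.rtL r)).frame a) ((rc.tent (rc.rtR r)).frame b) := by
  obtain ⟨hσL, hσR, hf, hg, hrn⟩ := μ.rframe_spec r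
  rw [hrn]
  exact (rc.tent (rc.rtL r)).sharedAxis_of_stacking_eq (rc.tent (rc.rtR r)) hσL hσR hf hg a b

include μ in
/-- The same with the grains exchanged. -/
theorem sharedAxis_columns' (r : Fin rc.nr) (a b : ℤ) : SharedAxis (rc.rn r) ((rc.tent (rc.rtR r)).frame b) ((rc.tent (rc.rtL r)).frame a) := by
  obtain ⟨hσL, hσR, hf, hg, hrn⟩ := μ.rframe_spec r
  rw [hrn]
  exact (rc.tent (rc.rtR r)).sharedAxis_of_stacking_eq (rc.tent (rc.rtL r)) hσR hσL hg hf b a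

/-- **A horizontal contact between the two column grains is free** (`f` first). -/
theorem lawW_columns_eq_zero_of_pm_rn {r : Fin rc.nr} {i i' : Fin (μ.riserInput ct τ).cells.M}
    (hgi : (μ.riserInput ct τ).grain i = rc.rtL r) (hgi' : (μ.riserInput ct τ).grain i' = rc.rtR r) {ν : E3} (hν : ν = rc.rn r ∨ ν = -rc.rn r) :
    lawW (μ.riserInput ct τ).frameOf ((μ.riserInput ct τ).cells.cls i) ((μ.riserInput ct τ).cells.cls i') ν = 0 := by
  have hax : SharedAxis (rc.rn r) ((μ.riserInput ct τ).frameOf ((μ.riserInput ct τ).cells.cls i))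
      ((μ.riserInput ct τ).frameOf ((μ.riserInput ct τ).cells.cls i')) := by
    rw [(μ.riserInput ct τ).frameOf_cls i, (μ.riserInput ct τ).frameOf_cls i', hgi, hgi']
    exact sharedAxis_columns μ r _ _
  have h0 := lawW_eq_zero_of_sharedAxis (μ.riserInput ct τ).frameOf hax
  rcases hν with rfl | rfl
  · exact h0.1
  · exact h0.2

/-- **A horizontal contact between the two column grains is free** (`g` first). -/
theorem lawW_columns_eq_zero_of_pm_rn' {r : Fin rc.nr} {i i' : Fin (μ.riserInput ct τ).cells.M}
    (hgi : (μ.riserInput ct τ).grain i = rc.rtR r) (hgi' : (μ.riserInput ct τ).grain i' = rc.rtL r) {ν : E3} (hν : ν = rc.rn r ∨ ν = -rc.rn r) :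
    lawW (μ.riserInput ct τ).frameOf ((μ.riserInput ct τ).cells.cls i) ((μ.riserInput ct τ).cells.cls i') ν = 0 := by
  have hax : SharedAxis (rc.rn r) ((μ.riserInput ct τ).frameOf ((μ.riserInput ct τ).cells.cls i))
      ((μ.riserInput ct τ).frameOf ((μ.riserInput ct τ).cells.cls i')) := by
    rw [(μ.riserInput ct τ).frameOf_cls i, (μ.riserInput ct τ).frameOf_cls i', hgi, hgi']
    exact sharedAxis_columns' μ r _ _
  have h0 := lawW_eq_zero_of_sharedAxis (μ.riserInput ct τ).frameOf hax
  rcases hν with rfl | rfl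
  · exact h0.1
  · exact h0.2

/-! ### Row (RR): two cells of one box -/

/-- **ROW (RR) of `BoxRow`**: two cells of ONE riser box with different grains touch across a wall of the `f`-cell's hexagon prism (a CURTAIN special) or
across one of its faces (FREE by the shared axis). -/
theorem boxRow_same_box {r : Fin rc.nr} {i i' : Fin (μ.riserInput ct τ).cells.M}
    (hi : polytope ((μ.riserInput ct τ).cells.Hp i) ⊆ polytope (μ.HB r)) (hi' : polytope ((μ.riserInput ct τ).cells.Hp i') ⊆ polytope (μ.HB r))
    (hg : (μ.riserInput ct τ).grain i' ≠ (μ.riserInput ct τ).grain i) {p : E3 × ℝ} (hp : p ∈ (μ.riserInput ct τ).cells.Hp i) {y : E3}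
    (hy : y ∈ (μ.riserInput ct τ).contact i i' p) (hgen : (μ.riserInput ct τ).Generic p y) :
    (μ.riserInput ct τ).IsCurtainSpecial i i' p ∨
      lawW (μ.riserInput ct τ).frameOf ((μ.riserInput ct τ).cells.cls i) ((μ.riserInput ct τ).cells.cls i') p.1 = 0 := by
  have hne : i ≠ i' := fun e => hg (by rw [e])
  rcases μ.grain_box_mem ct τ hi with hfi | hgi
  · -- `i` is `f`-claimed: inside the hexagon prism of an occupied riser site
    obtain ⟨c, hc, hic⟩ := (μ.grain_box_eq_rtL_iff ct τ hi).1 hfi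
    have hgi' : (μ.riserInput ct τ).grain i' = rc.rtR r := by
      rcases μ.grain_box_mem ct τ hi' with h | h
      · exact absurd (h.trans hfi.symm) hg
      · exact h
    have hi'c : ¬ polytope ((μ.riserInput ct τ).cells.Hp i') ⊆ polytope (μ.hexPrism r c (μ.rlayer r c)) := fun h =>
      hg (by rw [hfi, (μ.grain_box_eq_rtL_iff ct τ hi').2 ⟨c, hc, h⟩])
    have hpG := (μ.riserInput ct τ).mem_of_contact_of_subset hne hp hy hgen (μ.hexPrism_subset_𝓗 ct τ hc) hic hi'c
    rcases μ.fst_of_mem_hexPrism hpG with h | h | h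
    · exact Or.inl ⟨r, hi, hi', h⟩
    · exact Or.inr (μ.lawW_columns_eq_zero_of_pm_rn ct τ hfi hgi' (Or.inl h))
    · exact Or.inr (μ.lawW_columns_eq_zero_of_pm_rn ct τ hfi hgi' (Or.inr h))
  · -- `i` is `g`: then `i'` is `f`-claimed
    have hfi' : (μ.riserInput ct τ).grain i' = rc.rtL r := by
      rcases μ.grain_box_mem ct τ hi' with h | h
      · exact h
      · exact absurd (h.trans hgi.symm) hg
    obtain ⟨c, hc, hi'c⟩ := (μ.grain_box_eq_rtL_iff ct τ hi').1 hfi'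
    have hic : ¬ polytope ((μ.riserInput ct τ).cells.Hp i) ⊆ polytope (μ.hexPrism r c (μ.rlayer r c)) := fun h =>
      hg (by rw [hfi', (μ.grain_box_eq_rtL_iff ct τ hi).2 ⟨c, hc, h⟩])
    have hpG := (μ.riserInput ct τ).antip_mem_of_contact_of_subset hne hp hy hgen (μ.hexPrism_subset_𝓗 ct τ hc) hi'c hic
    rcases μ.fst_of_mem_hexPrism hpG with h | h | h
    · refine Or.inl ⟨r, hi, hi', ?_⟩
      simp only [antip, inner_neg_left, neg_eq_zero] at h
      exact h
    · have hp1 : p.1 = -rc.rn r := by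
        simp only [antip] at h
        rw [← h, neg_neg]
      exact Or.inr (μ.lawW_columns_eq_zero_of_pm_rn' ct τ hgi hfi' (Or.inr hp1))
    · have hp1 : p.1 = rc.rn r := by
        simp only [antip] at h
        have := congrArg Neg.neg h
        simpa using this
      exact Or.inr (μ.lawW_columns_eq_zero_of_pm_rn' ct τ hgi hfi' (Or.inl hp1))

end Mesh₅

end Summit.Ventures.Crystal3D.Cruxes.TextureLiminf.TexShadow

end
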